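import Summits.Parity.BatemanHorn.Theorems.AlmostPrimeZerosSystemMomentDeficitAssembly
import Summits.Parity.BatemanHorn.Theorems.AlmostPrimeZerosSystemMomentDeficitCrtPairCount
import Summits.Parity.BatemanHorn.Theorems.AlmostPrimeZerosSystemMomentDeficitPrimePairTail
import Summits.Parity.BatemanHorn.Theorems.AlmostPrimeZerosSystemMomentDeficitPrimeWindow
import Summits.Parity.BatemanHorn.Theorems.AlmostPrimeZerosSystemMomentDeficitNearPairCov
import Summits.Parity.BatemanHorn.Theorems.AlmostPrimeZerosSystemMomentDeficitPairBookkeeping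
import Summits.Parity.BatemanHorn.Theorems.AlmostPrimeZerosSystemMomentDeficitLinearK1
import Summits.Parity.BatemanHorn.Theses.AlmostPrimeZeros

/-!
# Crux `SystemMomentDeficit` (stmt-Parity-11326), line `Ideator3Sketch`: the reduction to K1 and the all-linear case

Two consequences of the landed blocks of line `Ideator3Sketch` (CRT pair count, prime-pair tail,
Mertens window, near-pair covariance, pair bookkeeping, assembly):

* `systemMomentDeficit_of_decorrelatedCovarianceBound` — the crux
  `Summit.Parity.BatemanHorn.Theses.AlmostPrimeZeros.SystemMomentDeficit` follows from the single
  remaining stub K1 (`Cov(W, N) ≥ −C` for every Bateman–Horn system), taken as a hypothesis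
  verbatim: every other block of the line is a theorem of the tree.
* `systemMomentDeficit_local_of_decorrelatedCovarianceBound` — the same for ONE system `f`, from
  K1 for that `f` alone.
* `systemMomentDeficit_of_natDegree_eq_one` — UNCONDITIONALLY, the moment deficit `m₁(x) − v(x)`
  of the capped statistic `s_f` is bounded above for every Bateman–Horn system all of whose members
  are LINEAR (prime `k`-tuple systems: twin primes `(X, X+2)`, Sophie Germain `(X, 2X+1)`, …), by
  `decorrelatedCovarianceBound_of_natDegree_eq_one`.

Notation (docstrings only).  `s_f(n) = Σᵢ Σ_{p^v ∥ fᵢ(n)⁺} min(v, 2)`, `m₁(x) = (x+1)⁻¹ Σ_{n ≤ x} s_f(n)`,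
`v(x) = (x+1)⁻¹ Σ_{n ≤ x} s_f(n)² − m₁(x)²`.  Everything is [folklore] bookkeeping over the landed blocks.
-/

namespace Summit.Parity.BatemanHorn.Cruxes.SystemMomentDeficit.Ideator3Sketch

open scoped BigOperators
open Finset Polynomial
open Literature.NumberTheory.Sieve

/-- **The crux for one system from K1 for that system.**  For a Bateman–Horn system `f`, the
decorrelated covariance bound `Cov(W, N) ≥ −C` (`x ≥ 16`) for `f` implies
`m₁(x) − v(x) ≤ C'` for all `x ≥ 2`.  All other blocks of line `Ideator3Sketch` are discharged by
the tree theorems `stub_primePairTail`, `stub_primeWindow`, `stub_nearPairCov`,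
`stub_crtPairCount`, `stub_pairBookkeeping` and `assembly_local`. -/
theorem systemMomentDeficit_local_of_decorrelatedCovarianceBound
    (k : ℕ) (f : Fin k → ℤ[X]) (hf : IsBatemanHornSystem f)
    (hK1 : ∃ C : ℝ, ∀ x : ℕ, 16 ≤ x →
      -C ≤
        (∑ n ∈ Finset.range (x + 1),
            (∑ i, ∑ q ∈ (Nat.primesLE (Nat.sqrt (Nat.sqrt x)) ∪
                ((Nat.primesLE (Nat.sqrt (Nat.sqrt x))).filter
                  (fun p => p ^ 2 ≤ Nat.sqrt (Nat.sqrt x))).image (fun p => p ^ 2)).filter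
                (fun q => q ∣ ((f i).eval (n : ℤ)).toNat ∧ ((f i).eval (n : ℤ)).toNat ≠ 0),
              (1 - 2 * ArithmeticFunction.vonMangoldt q / Real.log (Nat.sqrt (Nat.sqrt x)))) *
            (((∑ i, (((f i).eval (n : ℤ)).toNat.factorization.sum fun _ v => min v 2) : ℕ) : ℝ) -
              ((∑ i, #((Nat.primesLE x ∪ ((Nat.primesLE x).filter (fun p => p ^ 2 ≤ x)).image
                  (fun p => p ^ 2)).filter
                (fun q => q ∣ ((f i).eval (n : ℤ)).toNat ∧ ((f i).eval (n : ℤ)).toNat ≠ 0)) : ℕ) : ℝ))) /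
            ((x : ℝ) + 1) -
          (∑ n ∈ Finset.range (x + 1),
              (∑ i, ∑ q ∈ (Nat.primesLE (Nat.sqrt (Nat.sqrt x)) ∪
                  ((Nat.primesLE (Nat.sqrt (Nat.sqrt x))).filter
                    (fun p => p ^ 2 ≤ Nat.sqrt (Nat.sqrt x))).image (fun p => p ^ 2)).filter
                  (fun q => q ∣ ((f i).eval (n : ℤ)).toNat ∧ ((f i).eval (n : ℤ)).toNat ≠ 0),
                (1 - 2 * ArithmeticFunction.vonMangoldt q / Real.log (Nat.sqrt (Nat.sqrt x))))) /
              ((x : ℝ) + 1) *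
            ((∑ n ∈ Finset.range (x + 1),
                (((∑ i, (((f i).eval (n : ℤ)).toNat.factorization.sum fun _ v => min v 2) : ℕ) : ℝ) -
                  ((∑ i, #((Nat.primesLE x ∪ ((Nat.primesLE x).filter (fun p => p ^ 2 ≤ x)).image
                      (fun p => p ^ 2)).filter
                    (fun q => q ∣ ((f i).eval (n : ℤ)).toNat ∧ ((f i).eval (n : ℤ)).toNat ≠ 0)) : ℕ) :
                    ℝ))) /
              ((x : ℝ) + 1))) :
    ∃ C : ℝ, ∀ x : ℕ, 2 ≤ x →
      ((∑ n ∈ Finset.range (x + 1), ∑ i, (((f i).eval (n : ℤ)).toNat.factorization.sum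
          fun _ v => min v 2) : ℕ) : ℝ) / ((x : ℝ) + 1) -
        (((∑ n ∈ Finset.range (x + 1), (∑ i, (((f i).eval (n : ℤ)).toNat.factorization.sum
            fun _ v => min v 2)) ^ 2 : ℕ) : ℝ) / ((x : ℝ) + 1) -
          (((∑ n ∈ Finset.range (x + 1), ∑ i, (((f i).eval (n : ℤ)).toNat.factorization.sum
              fun _ v => min v 2) : ℕ) : ℝ) / ((x : ℝ) + 1)) ^ 2) ≤ C := by
  obtain ⟨C, hC⟩ := assembly_local stub_primePairTail stub_primeWindow
    (stub_nearPairCov stub_crtPairCount) stub_pairBookkeeping k f hf hK1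
  exact exists_forall_ge_two_of_threshold hC

/-- **The crux from K1 (reduction of line `Ideator3Sketch`, all other stubs discharged).**  If the
decorrelated covariance bound `Cov(W, N) ≥ −C` holds for every Bateman–Horn system, then
`Summit.Parity.BatemanHorn.Theses.AlmostPrimeZeros.SystemMomentDeficit` holds.  (This is the
registered composition `SystemMomentDeficit_of` with its one open stub as an explicit hypothesis.) -/
theorem systemMomentDeficit_of_decorrelatedCovarianceBound
    (hK1 : ∀ (k : ℕ) (f : Fin k → ℤ[X]), IsBatemanHornSystem f → ∃ C : ℝ, ∀ x : ℕ, 16 ≤ x →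
      -C ≤
        (∑ n ∈ Finset.range (x + 1),
            (∑ i, ∑ q ∈ (Nat.primesLE (Nat.sqrt (Nat.sqrt x)) ∪
                ((Nat.primesLE (Nat.sqrt (Nat.sqrt x))).filter
                  (fun p => p ^ 2 ≤ Nat.sqrt (Nat.sqrt x))).image (fun p => p ^ 2)).filter
                (fun q => q ∣ ((f i).eval (n : ℤ)).toNat ∧ ((f i).eval (n : ℤ)).toNat ≠ 0),
              (1 - 2 * ArithmeticFunction.vonMangoldt q / Real.log (Nat.sqrt (Nat.sqrt x)))) *
            (((∑ i, (((f i).eval (n : ℤ)).toNat.factorization.sum fun _ v => min v 2) : ℕ) : ℝ) -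
              ((∑ i, #((Nat.primesLE x ∪ ((Nat.primesLE x).filter (fun p => p ^ 2 ≤ x)).image
                  (fun p => p ^ 2)).filter
                (fun q => q ∣ ((f i).eval (n : ℤ)).toNat ∧ ((f i).eval (n : ℤ)).toNat ≠ 0)) : ℕ) : ℝ))) /
            ((x : ℝ) + 1) -
          (∑ n ∈ Finset.range (x + 1),
              (∑ i, ∑ q ∈ (Nat.primesLE (Nat.sqrt (Nat.sqrt x)) ∪
                  ((Nat.primesLE (Nat.sqrt (Nat.sqrt x))).filter
                    (fun p => p ^ 2 ≤ Nat.sqrt (Nat.sqrt x))).image (fun p => p ^ 2)).filter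
                  (fun q => q ∣ ((f i).eval (n : ℤ)).toNat ∧ ((f i).eval (n : ℤ)).toNat ≠ 0),
                (1 - 2 * ArithmeticFunction.vonMangoldt q / Real.log (Nat.sqrt (Nat.sqrt x))))) /
              ((x : ℝ) + 1) *
            ((∑ n ∈ Finset.range (x + 1),
                (((∑ i, (((f i).eval (n : ℤ)).toNat.factorization.sum fun _ v => min v 2) : ℕ) : ℝ) -
                  ((∑ i, #((Nat.primesLE x ∪ ((Nat.primesLE x).filter (fun p => p ^ 2 ≤ x)).image
                      (fun p => p ^ 2)).filter
                    (fun q => q ∣ ((f i).eval (n : ℤ)).toNat ∧ ((f i).eval (n : ℤ)).toNat ≠ 0)) : ℕ) :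
                    ℝ))) /
              ((x : ℝ) + 1))) :
    Summit.Parity.BatemanHorn.Theses.AlmostPrimeZeros.SystemMomentDeficit := by
  unfold Summit.Parity.BatemanHorn.Theses.AlmostPrimeZeros.SystemMomentDeficit
  intro k f hf
  exact systemMomentDeficit_local_of_decorrelatedCovarianceBound k f hf (hK1 k f hf)

/-- **The crux for all-linear systems (unconditional).**  For every Bateman–Horn system
`f = (f₁, …, f_k)` with `deg fᵢ = 1` for all `i` (prime `k`-tuple systems) there is `C` with
`m₁(x) − v(x) ≤ C` for all `x ≥ 2`: the mean of the capped prime-factor count `s_f` exceeds its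
variance by at most a constant.  From `assembly_local`, the four elementary blocks, and K1 for
linear systems `decorrelatedCovarianceBound_of_natDegree_eq_one` (a linear value `≤ A x` has a
prime factor `> x` only with a cofactor `< A`, so `E N ≪ 1/log x`). -/
theorem systemMomentDeficit_of_natDegree_eq_one :
    ∀ (k : ℕ) (f : Fin k → ℤ[X]), IsBatemanHornSystem f → (∀ i, (f i).natDegree = 1) →
      ∃ C : ℝ, ∀ x : ℕ, 2 ≤ x →
      ((∑ n ∈ Finset.range (x + 1), ∑ i, (((f i).eval (n : ℤ)).toNat.factorization.sum
          fun _ v => min v 2) : ℕ) : ℝ) / ((x : ℝ) + 1) -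
        (((∑ n ∈ Finset.range (x + 1), (∑ i, (((f i).eval (n : ℤ)).toNat.factorization.sum
            fun _ v => min v 2)) ^ 2 : ℕ) : ℝ) / ((x : ℝ) + 1) -
          (((∑ n ∈ Finset.range (x + 1), ∑ i, (((f i).eval (n : ℤ)).toNat.factorization.sum
              fun _ v => min v 2) : ℕ) : ℝ) / ((x : ℝ) + 1)) ^ 2) ≤ C :=
  fun k f hf hdeg => systemMomentDeficit_local_of_decorrelatedCovarianceBound k f hf
    (decorrelatedCovarianceBound_of_natDegree_eq_one k f hf hdeg)

end Summit.Parity.BatemanHorn.Cruxes.SystemMomentDeficit.Ideator3Sketch
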